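import Summits.BirchSwinnertonDyer.BirchSwinnertonDyer.Theorems.MordellShaFreeCutThreeAdicLinks
import Summits.BirchSwinnertonDyer.BirchSwinnertonDyer.Theorems.MordellShaFreeCutAssembly
import Literature.NumberTheory.EllipticCurves.HeegnerFieldDescentProofs
import Literature.NumberTheory.EllipticCurves.BSDSelmerCMPConverseRankOneProofs
import Literature.NumberTheory.EllipticCurves.SelmerCorankIsogenyProofs
import Literature.NumberTheory.EllipticCurves.IsogenyVariableChangeProofs

/-! # Route `MordellShaFreeCut` (rung S2b) — crux `RankPosOfThreeSelmerCorankOne`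
(stmt-BirchSwinnertonDyer-19159, the route's declared RESIDUAL conjunct): the Ш-freeness half at the
ADDITIVE prime `3` of `E_D : y² = x³ + D` SPLIT WITH TEETH in MODULE CURRENCY — Link A in CORANK form
(named here, OPEN) + the typer's Link B (`MordellShaFreeCutThreeAdicLinks.ThreeAdicCharValueEqHeegnerLogSq`,
shared with crux B) ⟹ crux A, and with it the whole rung-S2b leaf from the TWO typed links plus
refereed facts (PROVED compositions) — the `p = 3` twin of `CongruentShaFreeCutTwoAdicLinksCorank`

Cell `bsd-cn100`, seat `bsd-cn100-transfer-2` g2 (twin filing for the S2b residual, which has no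
prover seated; D-0074 row (I) group). Supports, does not close, stmt-BirchSwinnertonDyer-19159.
HONEST FRAMING: nothing here proves crux A, crux B, the leaf `rankOne_threeConverse_mordellCurve`
(Sylvester / cube sums) or any case of BSD; ONE further open statement is NAMED (`@[conjecture] def`,
nothing asserted) and the compositions are PROVED.

## The corank link at `p = 3`

The typer's `Theorems/MordellShaFreeCutThreeAdicLinks.lean` (bsd-cn100-ty g2, p424081) splits crux B of
S2b over Castella's typed `Λ`-module `𝔛 = AcSelmer.XAc (W_K) 3 κ v̄ ∅ γ` for globally minimal `W/ℚ`
with `j = 0` (every `E_D` is `ℚ`-isomorphic to one; `E_D` is ADDITIVE at `3`, potentially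
supersingular, Eisenstein), `K` an auxiliary imaginary quadratic field with the Heegner hypothesis
for `N(W)` in which `3 = v v̄` SPLITS. For crux A the hypothesis `corank_{ℤ₃} Sel_{3^∞}(E_D/ℚ) = 1`
descends (`3`-parity + Hoffstein–Luo + modularity + Kato: `exists_heegnerField_descent_of_selmerCorank_eq_one`)
to corank one over such a `K`, so the algebraic link needed is

* `ThreeAdicControlOfCorankOne` — `corank_{ℤ₃} Sel_{3^∞}(W/K) = 1 ⟹ ∃ m, XAc.HasCharValuationAt … m`
  (same binders as the typer's `ThreeAdicControlOfRankOne`, hypothesis weakened from "rank one and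
  `Ш[3^∞]` finite" to "corank one"; IMPLIES that link). The converse-theorem step (excludes corank
  carried by Ш); shape of Skinner 2020 / CGLS 2022 §5.2 / Burungale–Tian 2020; OPEN at the additive
  prime `3` (Fan–Wan v2 §§5–6 / Kříž v5 treat the `ℚ(√−3)`-analogue at the ramified prime, unrefereed).

## What is PROVED

* `threeAdicControlOfRankOne_of_corankOne` (corank link ⟹ rank link);
* **`rankPos_minimal_of_threeAdicLinks`** — for globally minimal `W`, `j = 0`: corank one ⟹
  `1 ≤ rank W(ℚ)` from the two links + `3`-parity, modularity, Hoffstein–Luo, Kato, Gross's Heegner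
  points (descent field; Heegner point; anticyclotomic datum of the b2b CGLS adapter; the links force
  `log_ω(m₀•P_ι) ≠ 0`, `AcPConverseLinks.not_isOfFinAddOrder_of_links`; Mordell–Weil);
* **`cruxA_of_threeAdicLinks`** — `RankPosOfThreeSelmerCorankOne` for every `D ≠ 0` (global minimal
  model `C • E_D` of `j = 0`, `hasGlobalMinimalModel_rat_holds`; corank and rank are invariant under
  the change of variables: `isIsogenous_of_smul` + `IsIsogenous.selmerCorank_eq`,
  `mordellWeilRank_variableChange_holds`);
* **`leaf_of_threeAdicLinks`** — the rung-S2b leaf `rankOne_threeConverse_mordellCurve` from the same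
  two links + those facts + Gross–Zagier/Kolyvagin, through the typer's `cruxB_of_threeAdicLinks` and
  the route's `Assembly` (`MordellShaFreeCutAssembly.assembly_holds`). CONDITIONAL; credits nothing.

PARTITION: none (RANK axis; companion formula cell CornerF@3 ∩ {x³+y³} untouched). BSD not touched.

References: [Skinner2020Converse] Thm. 1.1 (shape of the control step); [CastellaGrossiLeeSkinner2022]
Thm. 5.1.1, §5.2; [Castella2018] Def. 2.2, Thm. 2.3, Thm. 3.2; [BertoliniDarmonPrasanna2013] Thm. 5.13;
[Gross1984] §§3–4; [Kato2004] Cor. 14.3; [DokchitserDokchitserAnnals2010] Thm. 1.4;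
[SilvermanAEC2009] III.3.1(b), IV.6.4, VII.2.2. -/

noncomputable section

open scoped Classical

namespace Summit.BirchSwinnertonDyer.BirchSwinnertonDyer.Theorems.MordellShaFreeCutThreeAdicLinksCorank

open WeierstrassCurve NumberField IsDedekindDomain Field Literature.NumberTheory.EllipticCurves
  Literature.NumberTheory.EllipticCurves.Castella2018
open Summit.BirchSwinnertonDyer.BirchSwinnertonDyer.Theses.MordellShaFreeCut
open Summit.BirchSwinnertonDyer.BirchSwinnertonDyer.Theorems.MordellShaFreeCutThreeAdicLinks
  (ThreeAdicControlOfRankOne ThreeAdicCharValueEqHeegnerLogSq cruxB_of_threeAdicLinks)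

/-! ## 1. The corank link (OPEN; named, nothing asserted) -/

/-- **Link A in CORANK currency at `p = 3` — anticyclotomic control for a globally minimal `W/ℚ`
with `j = 0` (the Mordell curves) at the ADDITIVE prime `3`, `p`-converse form.** For such `W`, an
imaginary quadratic `K` with the Heegner hypothesis for `N = N(W)` and with `3 = v v̄` split, an
embedding `ι : K ↪ ℚ₃` inducing `v`, the anticyclotomic `ℤ₃`-extension `κ` of `K` with topological
generator `γ`: if `corank_{ℤ₃} Sel_{3^∞}(W/K) = 1`, then `𝔛 = X_ac(W[3^∞])` over `K_∞` (relaxed at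
`v`, strict at `v̄`; `AcSelmer.XAc`) is `Λ`-torsion and a characteristic generator has `F(0) ≠ 0` —
`∃ m, AcSelmer.XAc.HasCharValuationAt … m`. Same binders as the typer's `ThreeAdicControlOfRankOne`
with "rank one and `Ш[3^∞]` finite" WEAKENED to "corank one" (so this IMPLIES that link,
`threeAdicControlOfRankOne_of_corankOne`); the control step of a `p`-CONVERSE theorem. SHAPE of
Skinner 2020 Thm. 1.1 / CGLS 2022 §5.2 / Burungale–Tian 2020; OPEN at the additive prime `3`.
Research-grade; nothing asserted; strictly weaker than crux A (no Heegner point, no `L`-value).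
[cite: CastellaGrossiLeeSkinner2022, Thm. 5.1.1 and §5.2 (shape only; nothing asserted)]
[cite: Castella2018, Def. 2.2 and Thm. 2.3 (arXiv:1704.06608 p. 5) (shape only; nothing asserted)] -/
@[conjecture] def ThreeAdicControlOfCorankOne : Prop :=
  ∀ (W : WeierstrassCurve ℚ) [W.IsElliptic] [W.IsGloballyMinimal], W.j = 0 →
    ∀ (K : Type) [Field K] [NumberField K] (N : ℕ) [NeZero N],
    W.conductorNorm ℤ = N → IsImaginaryQuadratic K →
      SatisfiesHeegnerHypothesis N K → SatisfiesHeegnerHypothesis 3 K →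
    ∀ (ι : K →+* ℚ_[3]) (v vbar : HeightOneSpectrum (𝓞 K)),
      (∀ x : 𝓞 K, x ∈ v.asIdeal ↔ ‖ι (x : K)‖ < 1) →
      ((3 : ℕ) : 𝓞 K) ∈ vbar.asIdeal → vbar ≠ v →
    ∀ (κ : ZpExtension K 3), κ.IsAnticyclotomic →
    ∀ (γ : absoluteGaloisGroup K) [Fact (κ.IsTopGenerator γ)],
      (W.baseChange K).selmerCorank 3 = 1 →
      ∃ m : ℕ, AcSelmer.XAc.HasCharValuationAt (W.baseChange K) 3 κ vbar ∅ γ m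

/-! ## 2. Small companions (PROVED) -/

/-- **The corank link implies the typer's rank link** (`rank 1 ∧ #Ш[3^∞] < ∞ ⟹ corank 1`,
`selmerCorank_eq_one_of_mordellWeilRank_eq_one_of_finite`). [cite: CastellaGrossiLeeSkinner2022, §5.2 (shape only)] -/
theorem threeAdicControlOfRankOne_of_corankOne (hA : ThreeAdicControlOfCorankOne) :
    ThreeAdicControlOfRankOne := by
  intro W _ _ hj K _ _ N _ hN hK hHN hH3 ι v vbar hv hvbar hne κ hκ γ _ hrank hsha
  haveI : (W.baseChange K).IsElliptic := by rw [baseChange]; infer_instance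
  exact hA W hj K N hN hK hHN hH3 ι v vbar hv hvbar hne κ hκ γ
    (selmerCorank_eq_one_of_mordellWeilRank_eq_one_of_finite _ 3 hrank hsha)

/-! ## 3. Crux A from the two links (PROVED compositions) -/

/-- **Globally minimal `j = 0` case of crux A from the corank link, the typer's Link B and five
refereed facts** (`3`-parity, modularity, Hoffstein–Luo, Kato, Gross's Heegner points): descend to
the Heegner field `K` (`exists_heegnerField_descent_of_selmerCorank_eq_one`: corank one over `K`,
`rank W(K) = rank W(ℚ)`); take a Heegner point `P`; produce the anticyclotomic datum (b2b CGLS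
adapter); the two links force `P` non-torsion (`AcPConverseLinks.not_isOfFinAddOrder_of_links`);
Mordell–Weil. [cite: CastellaGrossiLeeSkinner2022, §5.2 (proof of Thm. 5.2.1)]
[cite: SilvermanAEC2009, IV.6.4 and VII.2.2] -/
theorem rankPos_minimal_of_threeAdicLinks
    (hpar : ∀ (W : WeierstrassCurve ℚ) [W.IsElliptic] (p : ℕ) [Fact p.Prime], p_parity W p)
    (hmod : ModularForms.exists_isNewformOf) (hHL : HoffsteinLuo1997_exists_twist_L_one_ne_zero)
    (hKato : ∀ (W : WeierstrassCurve ℚ) [W.IsElliptic] (p : ℕ) [Fact p.Prime],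
      kato_finite_of_L_one_ne_zero W p)
    (hHP : ∀ (W : WeierstrassCurve ℚ) (K : Type) [Field K] [NumberField K],
      exists_isHeegnerPoint W K)
    (hA : ThreeAdicControlOfCorankOne) (hB : ThreeAdicCharValueEqHeegnerLogSq) :
    ∀ (W : WeierstrassCurve ℚ) [W.IsElliptic] [W.IsGloballyMinimal], W.j = 0 →
      W.selmerCorank 3 = 1 → 1 ≤ W.mordellWeilRank := by
  intro W _ _ hj hc
  haveI : Fact (Nat.Prime 3) := ⟨Nat.prime_three⟩
  haveI : NeZero (W.conductorNorm ℤ) := ⟨(W.conductorNorm_pos_holds).ne'⟩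
  -- the descent field
  obtain ⟨K, _, _, hK, -, hHN, hH3, -, -, hcK, hrk, -⟩ :=
    exists_heegnerField_descent_of_selmerCorank_eq_one hpar hmod hHL hKato W 3 hc 0
  -- a Heegner point
  obtain ⟨P, hP⟩ := hHP W K hK hHN
  -- the anticyclotomic datum
  obtain ⟨κ, γ, 𝔭, hκ, hγ, h𝔭, he, hf⟩ :=
    Summit.BirchSwinnertonDyer.Rank1Residual.X11b.exists_anticyclotomic_generator_degreeOnePrime
      3 K hK hH3
  haveI : Fact (κ.IsTopGenerator γ) := ⟨hγ⟩
  let ι : K →+* ℚ_[3] := Summit.BirchSwinnertonDyer.Rank1Residual.X11b.embAt K 3 𝔭 h𝔭 he hf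
  obtain ⟨vbar, hvbar, hne⟩ :=
    Summit.BirchSwinnertonDyer.Rank1Residual.X11b.exists_other_prime hH3
      (Summit.BirchSwinnertonDyer.Rank1Residual.X11b.inducedPlace ι)
      (Summit.BirchSwinnertonDyer.Rank1Residual.X11b.natCast_mem_inducedPlace ι)
  have hv := Summit.BirchSwinnertonDyer.Rank1Residual.X11b.mem_inducedPlace_iff ι
  -- the two links force `P` to be non-torsion
  have hPnt : ¬ IsOfFinAddOrder P :=
    AcPConverseLinks.not_isOfFinAddOrder_of_links W 3 κ vbar γ ι P
      (hA W hj K (W.conductorNorm ℤ) rfl hK hHN hH3 ι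
        (Summit.BirchSwinnertonDyer.Rank1Residual.X11b.inducedPlace ι) vbar hv hvbar hne κ hκ γ hcK)
      (hB W hj K (W.conductorNorm ℤ) rfl hK hHN hH3 ι
        (Summit.BirchSwinnertonDyer.Rank1Residual.X11b.inducedPlace ι) vbar hv hvbar hne κ hκ γ hcK
        P hP)
  -- Mordell–Weil over `K`, descent by the rank equality
  have hrkK : 1 ≤ (W.baseChange K).mordellWeilRank :=
    one_le_mordellWeilRank_of_not_isOfFinAddOrder _ (W.baseChange K).module_finite_point_holds hPnt
  rwa [hrk] at hrkK

/-- **Crux A `RankPosOfThreeSelmerCorankOne` of S2b from the two `3`-adic links and five refereed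
facts**: every `E_D`, `D ≠ 0`, has a GLOBALLY MINIMAL model `C • E_D` (`hasGlobalMinimalModel_rat_holds`)
with `j = 0`, and Selmer corank and Mordell–Weil rank are invariant under the change of variables
(`isIsogenous_of_smul` with `IsIsogenous.selmerCorank_eq`; `mordellWeilRank_variableChange_holds`).
CONDITIONAL on the two open links; credits nothing. [cite: SilvermanAEC2009, III.3.1(b) and VIII.8]
[cite: CastellaGrossiLeeSkinner2022, §5.2 (proof of Thm. 5.2.1)] -/
theorem cruxA_of_threeAdicLinks
    (hpar : ∀ (W : WeierstrassCurve ℚ) [W.IsElliptic] (p : ℕ) [Fact p.Prime], p_parity W p)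
    (hmod : ModularForms.exists_isNewformOf) (hHL : HoffsteinLuo1997_exists_twist_L_one_ne_zero)
    (hKato : ∀ (W : WeierstrassCurve ℚ) [W.IsElliptic] (p : ℕ) [Fact p.Prime],
      kato_finite_of_L_one_ne_zero W p)
    (hHP : ∀ (W : WeierstrassCurve ℚ) (K : Type) [Field K] [NumberField K],
      exists_isHeegnerPoint W K)
    (hA : ThreeAdicControlOfCorankOne) (hB : ThreeAdicCharValueEqHeegnerLogSq) :
    RankPosOfThreeSelmerCorankOne := by
  intro D hD hc
  haveI := isElliptic_mordellCurve hD
  haveI : Fact (Nat.Prime 3) := ⟨Nat.prime_three⟩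
  obtain ⟨C, hmin⟩ := hasGlobalMinimalModel_rat_holds (mordellCurve D)
  haveI : (C • mordellCurve D).IsGloballyMinimal := hmin
  have hj : (C • mordellCurve D).j = 0 := by
    rw [variableChange_j]; exact (mordellCurve D).j_eq_zero (mordellCurve_c₄ _)
  have hc' : (C • mordellCurve D).selmerCorank 3 = 1 := by
    rw [(isIsogenous_of_smul (mordellCurve D) C).selmerCorank_eq 3]; exact hc
  have h1 := rankPos_minimal_of_threeAdicLinks hpar hmod hHL hKato hHP hA hB (C • mordellCurve D) hj hc'
  rwa [mordellWeilRank_variableChange_holds] at h1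

/-! ## 4. The whole rung-S2b leaf from the two links (PROVED composition) -/

/-- **The rung-S2b leaf `rankOne_threeConverse_mordellCurve` from the TWO typed `3`-adic links**
(corank form of Link A, Link B) **and refereed facts** (`3`-parity, modularity, Hoffstein–Luo, Kato,
Gross's Heegner points, Gross–Zagier + Kolyvagin `hGZ`): crux A by `cruxA_of_threeAdicLinks`, crux B
by the typer's `cruxB_of_threeAdicLinks` (rank-form Link A from the corank form), and the route's
`Assembly` (`MordellShaFreeCutAssembly.assembly_holds`). CONDITIONAL; credits nothing; neither BSD
nor Sylvester's conjecture is touched. [cite: GrossZagier1986, Thm. I.6.3 with V.§2]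
[cite: CastellaGrossiLeeSkinner2022, §5.2 (proof of Thm. 5.2.1)] -/
theorem leaf_of_threeAdicLinks
    (hpar : ∀ (W : WeierstrassCurve ℚ) [W.IsElliptic] (p : ℕ) [Fact p.Prime], p_parity W p)
    (hmod : ModularForms.exists_isNewformOf) (hHL : HoffsteinLuo1997_exists_twist_L_one_ne_zero)
    (hKato : ∀ (W : WeierstrassCurve ℚ) [W.IsElliptic] (p : ℕ) [Fact p.Prime],
      kato_finite_of_L_one_ne_zero W p)
    (hHP : ∀ (W : WeierstrassCurve ℚ) (K : Type) [Field K] [NumberField K],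
      exists_isHeegnerPoint W K)
    (hGZ : ∀ (W : WeierstrassCurve ℚ) (N : ℕ) [NeZero N] (K : Type) [Field K] [NumberField K],
      analyticRankEK_eq_one_iff_heegner_nonTorsion W N K)
    (hA : ThreeAdicControlOfCorankOne) (hB : ThreeAdicCharValueEqHeegnerLogSq) :
    rankOne_threeConverse_mordellCurve :=
  MordellShaFreeCutAssembly.assembly_holds (cruxA_of_threeAdicLinks hpar hmod hHL hKato hHP hA hB)
    (cruxB_of_threeAdicLinks hpar hmod hHL hKato hHP hGZ (threeAdicControlOfRankOne_of_corankOne hA) hB)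

end Summit.BirchSwinnertonDyer.BirchSwinnertonDyer.Theorems.MordellShaFreeCutThreeAdicLinksCorank

end
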